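import Mathlib.Analysis.Complex.PhragmenLindelof
import Mathlib.Analysis.SpecialFunctions.Complex.Log
import Mathlib.Analysis.SpecialFunctions.Trigonometric.Bounds
import HarnessLib

/-!
# Entire functions of exponential type: Phragmén–Lindelöf in sectors and the indicator inequality
# `h(0) + h(π) ≥ 0`

Topic `Literature/Analysis/Complex`. Everything in this file is PROVED (no named facts). It supplies
the function-theoretic half of the "positive-density" step of Voronin's universality theorem
(Steuding, *Value-Distribution of L-Functions*, §5.3: Lemma 5.8 is the statement that a non-zero
entire function `f(s) = ∫ e^{sz} dμ(z)` of exponential type cannot decay faster along the positive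
real axis than the support of `μ` allows; we prove the underlying theorem of the theory of the
Phragmén–Lindelöf indicator, Boas, *Entire Functions*, §5.4: `h(θ) + h(θ + π) ≥ 0`), in the
following concrete forms:

* `PhragmenLindelof.sector_of_norm_le_exp` — **Phragmén–Lindelöf in a sector of opening `< π`**
  for entire functions of exponential type: bounded by `C` on the two bounding rays ⇒ bounded by
  `C` in the closed sector (Mathlib's `PhragmenLindelof.horizontal_strip` transported by `exp`).
* `norm_le_exp_quadrant_I` (`_II`, `_IV`), `norm_le_exp_of_re_nonneg` — the quadrant version
  with exponential weights: `‖G(x)‖ ≤ C₁ e^{sx}` (`x ≥ 0`) and `‖G(iy)‖ ≤ C₂ e^{R|y|}` give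
  `‖G(x+iy)‖ ≤ max C₁ C₂ · e^{sx + R|y|}` on `Re z ≥ 0` (Mathlib's `PhragmenLindelof.quadrant_I`).
* `norm_le_exp_neg_of_decay` — an entire `ρ` with `‖ρ(z)‖ ≤ C e^{R‖z‖}` and
  `‖ρ(x)‖ ≤ C' e^{-ax}` for `x ≥ 0`, `a > R ≥ 0`, decays faster than every exponential along the
  imaginary axis (`exists_angle_of_lt` chooses the angle);
* `eq_zero_of_norm_le_exp_of_decay` — **the indicator inequality** in the form used for
  Voronin's theorem: such a `ρ` vanishes identically (equivalently: a non-zero entire function with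
  `‖ρ(z)‖ ≤ C e^{R‖z‖}` has `limsup_{x→+∞} log‖ρ(x)‖/x ≥ -R`; Steuding's Lemma 5.8 / Kowalski's
  Lemma A.5.2 (3) for measures supported in `|z| ≤ R`).

Proof of the last statement (Boas §5.4 in PL language): by the sector principle applied to
`ρ(z) e^{(a - iV)z}` on `0 ≤ arg z ≤ π - θ₀` (`θ₀ = θ₀(V)` small) one gets `‖ρ(iy)‖ ≤ K e^{-Vy}`
for every `V`, and symmetrically below; the quadrant principle then gives super-exponential decay
on the rays `arg z = ±π/4` and boundedness on `arg z = ±3π/4`, and Mathlib's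
`PhragmenLindelof.eq_zero_on_right_half_plane_of_superexponential_decay` (for `z ↦ ρ(e^{iπ/4} z)`)
and the identity theorem finish.

## References

* [Steuding2007] J. Steuding, *Value-Distribution of L-Functions*, LNM 1877, Springer 2007, §5.3,
  Lemma 5.8.
* [Boas1954] R. P. Boas, *Entire Functions*, Academic Press 1954, §1.4 (Phragmén–Lindelöf in an
  angle), §5.4 (properties of the indicator: `h(θ) + h(θ+π) ≥ 0`).
* [Kowalski2021] E. Kowalski, *An Introduction to Probabilistic Number Theory*, CUP 2021,
  Lemma A.5.2 (3).
-/

noncomputable section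

open Complex Filter Topology Set Metric Asymptotics Bornology

namespace PhragmenLindelof

/-- **Phragmén–Lindelöf principle in a sector of opening `< π` for entire functions of exponential
type.** If `f` is entire with `‖f(z)‖ ≤ A e^{B‖z‖}`, and `‖f‖ ≤ C` on the rays `arg z = θ₁` and
`arg z = θ₁ + α` with `0 < α < π`, then `‖f(r e^{iθ})‖ ≤ C` for `r ≥ 0`, `θ₁ ≤ θ ≤ θ₁ + α`.
(Mathlib's `horizontal_strip` for `f ∘ exp` on `0 < Im w < α`, growth `exp(B e^{|Re w|})`,
`1 < π/α`.) [cite: Boas1954, §1.4 (Thm. 1.4.2)] -/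
theorem sector_of_norm_le_exp {f : ℂ → ℂ} (hf : Differentiable ℂ f) {A B : ℝ}
    (hB : ∀ z, ‖f z‖ ≤ A * Real.exp (B * ‖z‖)) {θ₁ α : ℝ} (hα0 : 0 < α) (hαπ : α < Real.pi)
    {C : ℝ} (h₀ : ∀ r : ℝ, 0 ≤ r → ‖f (r * exp (θ₁ * I))‖ ≤ C)
    (h₁ : ∀ r : ℝ, 0 ≤ r → ‖f (r * exp ((θ₁ + α) * I))‖ ≤ C)
    {r θ : ℝ} (hr : 0 ≤ r) (hθ0 : θ₁ ≤ θ) (hθα : θ ≤ θ₁ + α) :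
    ‖f (r * exp (θ * I))‖ ≤ C := by
  rcases hr.eq_or_lt with rfl | hr
  · simpa using h₀ 0 le_rfl
  have hA : 0 ≤ A := by
    have h := (norm_nonneg _).trans (hB 0)
    simpa using h
  -- `g = f ∘ exp ∘ (· + θ₁ I)` on the strip `0 < im < α`
  set g : ℂ → ℂ := fun w ↦ f (exp (w + θ₁ * I)) with hg
  have hgd : Differentiable ℂ g :=
    hf.comp ((differentiable_id.add_const _).cexp)
  have hval : f (r * exp (θ * I)) = g (Real.log r + (θ - θ₁) * I) := by
    simp only [hg]
    congr 1
    rw [show (Real.log r : ℂ) + ((θ : ℂ) - θ₁) * I + θ₁ * I = Real.log r + θ * I by ring,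
      Complex.exp_add, ← Complex.ofReal_exp, Real.exp_log hr]
  rw [hval]
  have hnorm : ∀ w : ℂ, ‖cexp (w + θ₁ * I)‖ = Real.exp w.re := fun w ↦ by
    rw [Complex.norm_exp, add_re, mul_I_re, ofReal_im, neg_zero, add_zero]
  refine horizontal_strip (a := 0) (b := α) hgd.diffContOnCl ?_ ?_ ?_ ?_ ?_
  · refine ⟨1, ?_, max B 0, ?_⟩
    · rw [sub_zero, lt_div_iff₀ hα0, one_mul]; exact hαπ
    · refine IsBigO.of_bound A (Eventually.of_forall fun w ↦ ?_)
      rw [Real.norm_of_nonneg (Real.exp_pos _).le, one_mul]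
      refine (hB _).trans ?_
      rw [hnorm]
      gcongr A * Real.exp ?_
      calc B * Real.exp w.re ≤ max B 0 * Real.exp w.re := by gcongr; exact le_max_left _ _
        _ ≤ max B 0 * Real.exp |w.re| :=
          mul_le_mul_of_nonneg_left (Real.exp_le_exp.2 (le_abs_self _)) (le_max_right _ _)
  · intro w hw
    have hw' : w = (w.re : ℂ) := by apply Complex.ext <;> simp [hw]
    have hexp : cexp (w + θ₁ * I) = Real.exp w.re * cexp (θ₁ * I) := by
      conv_lhs => rw [hw']
      rw [Complex.exp_add, ← Complex.ofReal_exp]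
    show ‖f (cexp (w + θ₁ * I))‖ ≤ C
    rw [hexp]
    exact h₀ _ (Real.exp_pos _).le
  · intro w hw
    have hw' : w = (w.re : ℂ) + α * I := by apply Complex.ext <;> simp [hw]
    have hexp : cexp (w + θ₁ * I) = Real.exp w.re * cexp ((θ₁ + α) * I) := by
      conv_lhs => rw [hw']
      rw [show (w.re : ℂ) + α * I + θ₁ * I = w.re + (θ₁ + α) * I by ring,
        Complex.exp_add, ← Complex.ofReal_exp]
    show ‖f (cexp (w + θ₁ * I))‖ ≤ C
    rw [hexp]
    exact_mod_cast h₁ _ (Real.exp_pos _).le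
  · simp; linarith
  · simp; linarith

end PhragmenLindelof
namespace Literature.Analysis.Complex

/-! ### Quadrants with exponential weights -/

/-- A bound `‖f(z)‖ ≤ A e^{B‖z‖}` gives the growth hypothesis of Mathlib's Phragmén–Lindelöf
lemmas (`c = 1 < 2`) along any filter. [folklore] -/
theorem isBigO_exp_of_norm_le_exp {f : ℂ → ℂ} {A B : ℝ}
    (hB : ∀ z, ‖f z‖ ≤ A * Real.exp (B * ‖z‖)) (l : Filter ℂ) :
    ∃ c < (2 : ℝ), ∃ B', f =O[l] fun z ↦ Real.exp (B' * ‖z‖ ^ c) := by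
  refine ⟨1, one_lt_two, B, IsBigO.of_bound A (Eventually.of_forall fun z ↦ ?_)⟩
  rw [Real.rpow_one, Real.norm_of_nonneg (Real.exp_pos _).le]
  exact hB z

/-- The constant in a bound `‖f(z)‖ ≤ A e^{B‖z‖}` is nonnegative. [folklore] -/
theorem nonneg_of_norm_le_exp {f : ℂ → ℂ} {A B : ℝ}
    (hB : ∀ z, ‖f z‖ ≤ A * Real.exp (B * ‖z‖)) : 0 ≤ A := by
  have h := (norm_nonneg _).trans (hB 0)
  simpa using h

/-- **Phragmén–Lindelöf in the first quadrant with exponential weights.** If `G` is entire of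
exponential type, `‖G(x)‖ ≤ C₁ e^{sx}` for `x ≥ 0` and `‖G(iy)‖ ≤ C₂ e^{ty}` for `y ≥ 0`, then
`‖G(z)‖ ≤ max C₁ C₂ · e^{s Re z + t Im z}` on the closed first quadrant (apply Mathlib's
`PhragmenLindelof.quadrant_I` to `e^{-(s - it) z} G(z)`). [cite: Boas1954, §1.4] -/
theorem norm_le_exp_quadrant_I {G : ℂ → ℂ} (hG : Differentiable ℂ G) {A B : ℝ}
    (hAB : ∀ z, ‖G z‖ ≤ A * Real.exp (B * ‖z‖)) {C₁ C₂ s t : ℝ}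
    (hre : ∀ x : ℝ, 0 ≤ x → ‖G x‖ ≤ C₁ * Real.exp (s * x))
    (him : ∀ y : ℝ, 0 ≤ y → ‖G (y * I)‖ ≤ C₂ * Real.exp (t * y)) {z : ℂ} (hz_re : 0 ≤ z.re)
    (hz_im : 0 ≤ z.im) :
    ‖G z‖ ≤ max C₁ C₂ * Real.exp (s * z.re + t * z.im) := by
  set w : ℂ := (s : ℂ) - t * I with hw
  have hw_re : w.re = s := by simp [hw]
  have hw_im : w.im = -t := by simp [hw]
  have hwre : ∀ z : ℂ, (w * z).re = s * z.re + t * z.im := by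
    intro z; rw [mul_re, hw_re, hw_im]; ring
  set F : ℂ → ℂ := fun z ↦ exp (-(w * z)) * G z with hF
  have hFd : Differentiable ℂ F := ((differentiable_id.const_mul w).neg.cexp).mul hG
  have hFnorm : ∀ z, ‖F z‖ = Real.exp (-(s * z.re + t * z.im)) * ‖G z‖ := by
    intro z; simp only [hF]; rw [norm_mul, Complex.norm_exp, neg_re, hwre]
  have hA : 0 ≤ A := nonneg_of_norm_le_exp hAB
  have hFbound : ∀ z, ‖F z‖ ≤ A * Real.exp ((B + ‖w‖) * ‖z‖) := by
    intro z
    simp only [hF]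
    rw [norm_mul, Complex.norm_exp]
    have h1 : (-(w * z)).re ≤ ‖w‖ * ‖z‖ := by
      calc (-(w * z)).re ≤ ‖-(w * z)‖ := re_le_norm _
        _ = ‖w‖ * ‖z‖ := by rw [norm_neg, norm_mul]
    calc Real.exp ((-(w * z)).re) * ‖G z‖ ≤ Real.exp (‖w‖ * ‖z‖) * (A * Real.exp (B * ‖z‖)) :=
          mul_le_mul (Real.exp_le_exp.2 h1) (hAB z) (norm_nonneg _) (Real.exp_pos _).le
      _ = A * Real.exp ((B + ‖w‖) * ‖z‖) := by rw [add_mul, Real.exp_add]; ring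
  have key : ‖F z‖ ≤ max C₁ C₂ := by
    refine PhragmenLindelof.quadrant_I hFd.diffContOnCl (isBigO_exp_of_norm_le_exp hFbound _)
      (fun x hx ↦ ?_) (fun y hy ↦ ?_) hz_re hz_im
    · rw [hFnorm]
      simp only [ofReal_re, ofReal_im, mul_zero, add_zero]
      calc Real.exp (-(s * x)) * ‖G x‖ ≤ Real.exp (-(s * x)) * (C₁ * Real.exp (s * x)) :=
            mul_le_mul_of_nonneg_left (hre x hx) (Real.exp_pos _).le
        _ = C₁ := by
            rw [mul_comm, mul_assoc, ← Real.exp_add, add_neg_cancel, Real.exp_zero, mul_one]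
        _ ≤ max C₁ C₂ := le_max_left _ _
    · rw [hFnorm]
      simp only [mul_I_re, mul_I_im, ofReal_re, ofReal_im, neg_zero, mul_zero, zero_add]
      calc Real.exp (-(t * y)) * ‖G (y * I)‖ ≤ Real.exp (-(t * y)) * (C₂ * Real.exp (t * y)) :=
            mul_le_mul_of_nonneg_left (him y hy) (Real.exp_pos _).le
        _ = C₂ := by
            rw [mul_comm, mul_assoc, ← Real.exp_add, add_neg_cancel, Real.exp_zero, mul_one]
        _ ≤ max C₁ C₂ := le_max_right _ _
  rw [hFnorm] at key
  calc ‖G z‖ = Real.exp (s * z.re + t * z.im) * (Real.exp (-(s * z.re + t * z.im)) * ‖G z‖) := by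
        rw [← mul_assoc, ← Real.exp_add, add_neg_cancel, Real.exp_zero, one_mul]
    _ ≤ Real.exp (s * z.re + t * z.im) * max C₁ C₂ :=
        mul_le_mul_of_nonneg_left key (Real.exp_pos _).le
    _ = max C₁ C₂ * Real.exp (s * z.re + t * z.im) := mul_comm _ _

/-- The second-quadrant version: data on `iℝ₊` (rate `t`) and on `ℝ₋` (rate `s` in `|x|`).
[cite: Boas1954, §1.4] -/
theorem norm_le_exp_quadrant_II {G : ℂ → ℂ} (hG : Differentiable ℂ G) {A B : ℝ}
    (hAB : ∀ z, ‖G z‖ ≤ A * Real.exp (B * ‖z‖)) {C₁ C₂ s t : ℝ}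
    (hre : ∀ x : ℝ, 0 ≤ x → ‖G (-x)‖ ≤ C₁ * Real.exp (s * x))
    (him : ∀ y : ℝ, 0 ≤ y → ‖G (y * I)‖ ≤ C₂ * Real.exp (t * y)) {z : ℂ} (hz_re : z.re ≤ 0)
    (hz_im : 0 ≤ z.im) :
    ‖G z‖ ≤ max C₂ C₁ * Real.exp (t * z.im + s * (-z.re)) := by
  -- `G₂ w = G (I w)` maps the first quadrant to the second
  set G₂ : ℂ → ℂ := fun w ↦ G (I * w) with hG₂
  have hG₂d : Differentiable ℂ G₂ := hG.comp (differentiable_id.const_mul I)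
  have hAB₂ : ∀ w, ‖G₂ w‖ ≤ A * Real.exp (B * ‖w‖) := fun w ↦ by
    simp only [hG₂]; simpa [norm_mul] using hAB (I * w)
  have hre₂ : ∀ x : ℝ, 0 ≤ x → ‖G₂ x‖ ≤ C₂ * Real.exp (t * x) := fun x hx ↦ by
    simp only [hG₂]; rw [mul_comm]; exact him x hx
  have him₂ : ∀ y : ℝ, 0 ≤ y → ‖G₂ (y * I)‖ ≤ C₁ * Real.exp (s * y) := fun y hy ↦ by
    simp only [hG₂]
    rw [show I * (y * I) = -(y : ℂ) by ring_nf; rw [I_sq]; ring]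
    exact hre y hy
  have h := norm_le_exp_quadrant_I hG₂d hAB₂ hre₂ him₂ (z := -I * z)
    (by simp; exact hz_im) (by simp; linarith)
  have hz : I * (-I * z) = z := by ring_nf; rw [I_sq]; ring
  simp only [hG₂, hz] at h
  simpa using h

/-- The fourth-quadrant version: data on `ℝ₊` (rate `s`) and on `iℝ₋` (rate `t` in `|y|`).
[cite: Boas1954, §1.4] -/
theorem norm_le_exp_quadrant_IV {G : ℂ → ℂ} (hG : Differentiable ℂ G) {A B : ℝ}
    (hAB : ∀ z, ‖G z‖ ≤ A * Real.exp (B * ‖z‖)) {C₁ C₂ s t : ℝ}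
    (hre : ∀ x : ℝ, 0 ≤ x → ‖G x‖ ≤ C₁ * Real.exp (s * x))
    (him : ∀ y : ℝ, 0 ≤ y → ‖G (-(y * I))‖ ≤ C₂ * Real.exp (t * y)) {z : ℂ} (hz_re : 0 ≤ z.re)
    (hz_im : z.im ≤ 0) :
    ‖G z‖ ≤ max C₂ C₁ * Real.exp (t * (-z.im) + s * z.re) := by
  -- `G₄ w = G (-I w)` maps the first quadrant to the fourth
  set G₄ : ℂ → ℂ := fun w ↦ G (-I * w) with hG₄
  have hG₄d : Differentiable ℂ G₄ := hG.comp (differentiable_id.const_mul (-I))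
  have hAB₄ : ∀ w, ‖G₄ w‖ ≤ A * Real.exp (B * ‖w‖) := fun w ↦ by
    simp only [hG₄]; simpa [norm_mul] using hAB (-I * w)
  have hre₄ : ∀ x : ℝ, 0 ≤ x → ‖G₄ x‖ ≤ C₂ * Real.exp (t * x) := fun x hx ↦ by
    simp only [hG₄]; rw [show -I * (x : ℂ) = -(x * I) by ring]; exact him x hx
  have him₄ : ∀ y : ℝ, 0 ≤ y → ‖G₄ (y * I)‖ ≤ C₁ * Real.exp (s * y) := fun y hy ↦ by
    simp only [hG₄]
    rw [show -I * (y * I) = (y : ℂ) by ring_nf; rw [I_sq]; ring]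
    exact hre y hy
  have h := norm_le_exp_quadrant_I hG₄d hAB₄ hre₄ him₄ (z := I * z)
    (by simp; linarith) (by simp; exact hz_re)
  have hz : -I * (I * z) = z := by ring_nf; rw [I_sq]; ring
  simp only [hG₄, hz] at h
  simpa using h

/-- **Right half-plane with exponential weights**: `‖G(x)‖ ≤ C₁ e^{sx}` (`x ≥ 0`) and
`‖G(iy)‖ ≤ C₂ e^{R|y|}` (all real `y`) give `‖G(z)‖ ≤ max C₁ C₂ · e^{s Re z + R |Im z|}` for
`Re z ≥ 0`. [cite: Boas1954, §1.4] -/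
theorem norm_le_exp_of_re_nonneg {G : ℂ → ℂ} (hG : Differentiable ℂ G) {A B : ℝ}
    (hAB : ∀ z, ‖G z‖ ≤ A * Real.exp (B * ‖z‖)) {C₁ C₂ s R : ℝ}
    (hre : ∀ x : ℝ, 0 ≤ x → ‖G x‖ ≤ C₁ * Real.exp (s * x))
    (him : ∀ y : ℝ, ‖G (y * I)‖ ≤ C₂ * Real.exp (R * |y|)) {z : ℂ} (hz : 0 ≤ z.re) :
    ‖G z‖ ≤ max C₁ C₂ * Real.exp (s * z.re + R * |z.im|) := by
  rcases le_total 0 z.im with hzi | hzi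
  · have h := norm_le_exp_quadrant_I hG hAB hre (C₂ := C₂) (t := R)
      (fun y hy ↦ by simpa [abs_of_nonneg hy] using him y) hz hzi
    rwa [abs_of_nonneg hzi]
  · have h := norm_le_exp_quadrant_IV hG hAB hre (C₂ := C₂) (t := R)
      (fun y hy ↦ by
        have := him (-y)
        rwa [abs_neg, abs_of_nonneg hy, ofReal_neg, neg_mul] at this) hz hzi
    rw [abs_of_nonpos hzi, max_comm, add_comm]
    exact h


/-! ### The indicator inequality: decay on `ℝ₊` faster than the type forces `ρ = 0` -/

/-- The small angle: for `a > R ≥ 0` and `V ≥ 0` there is `θ₀ ∈ (0, 1/2]` with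
`a cos θ₀ - V sin θ₀ ≥ R`. [folklore] -/
theorem exists_angle_of_lt {R a V : ℝ} (hR0 : 0 ≤ R) (ha : R < a) (hV : 0 ≤ V) :
    ∃ θ₀ : ℝ, 0 < θ₀ ∧ θ₀ ≤ 1 / 2 ∧ R ≤ a * Real.cos θ₀ - V * Real.sin θ₀ := by
  have ha0 : 0 < a := hR0.trans_lt ha
  set θ₀ : ℝ := min (1 / 2) ((a - R) / (a + 2 * V + 1)) with hθ₀
  have hden : 0 < a + 2 * V + 1 := by linarith
  have hθpos : 0 < θ₀ := lt_min (by norm_num) (div_pos (by linarith) hden)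
  have hθhalf : θ₀ ≤ 1 / 2 := min_le_left _ _
  have hθle : θ₀ ≤ (a - R) / (a + 2 * V + 1) := min_le_right _ _
  refine ⟨θ₀, hθpos, hθhalf, ?_⟩
  have hcos : 1 - θ₀ ^ 2 / 2 ≤ Real.cos θ₀ := Real.one_sub_sq_div_two_le_cos
  have hsin : Real.sin θ₀ ≤ θ₀ := Real.sin_le hθpos.le
  have h1 : (a / 4 + V) * θ₀ ≤ (a - R) / 2 := by
    calc (a / 4 + V) * θ₀ ≤ (a / 4 + V) * ((a - R) / (a + 2 * V + 1)) :=
          mul_le_mul_of_nonneg_left hθle (by linarith)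
      _ ≤ (a - R) / 2 := by
          rw [mul_div_assoc', div_le_div_iff₀ hden two_pos]
          nlinarith [mul_nonneg (sub_nonneg.2 ha.le) (by linarith : (0 : ℝ) ≤ a / 2 + 1)]
  have h2 : a * θ₀ ^ 2 ≤ a * (θ₀ / 2) := mul_le_mul_of_nonneg_left (by nlinarith) ha0.le
  have h3 : a * (1 - θ₀ ^ 2 / 2) ≤ a * Real.cos θ₀ := mul_le_mul_of_nonneg_left hcos ha0.le
  have h4 : V * Real.sin θ₀ ≤ V * θ₀ := mul_le_mul_of_nonneg_left hsin hV
  nlinarith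

/-- **Decay along the imaginary axis.** An entire `ρ` with `‖ρ(z)‖ ≤ C e^{R‖z‖}` (`R ≥ 0`) and
`‖ρ(x)‖ ≤ C' e^{-ax}` for `x ≥ 0` with `a > R` satisfies `‖ρ(±iy)‖ ≤ max C C' · e^{-Vy}`
(`y ≥ 0`) for every `V ≥ 0`: the Phragmén–Lindelöf principle in the sector
`0 ≤ arg z ≤ π - θ₀` (resp. `θ₀ - π ≤ arg z ≤ 0`) applied to `ρ(z) e^{(a ∓ iV) z}`
(Boas §5.4, proof of `h(θ) + h(θ+π) ≥ 0`). [cite: Boas1954, §5.4] -/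
theorem norm_le_exp_neg_of_decay {ρ : ℂ → ℂ} (hρ : Differentiable ℂ ρ) {C R : ℝ} (hR0 : 0 ≤ R)
    (hC : ∀ z, ‖ρ z‖ ≤ C * Real.exp (R * ‖z‖)) {C' a : ℝ} (ha : R < a)
    (hdec : ∀ x : ℝ, 0 ≤ x → ‖ρ x‖ ≤ C' * Real.exp (-(a * x))) {V : ℝ} (hV : 0 ≤ V)
    {y : ℝ} (hy : 0 ≤ y) :
    ‖ρ (y * I)‖ ≤ max C C' * Real.exp (-(V * y)) ∧
      ‖ρ (-(y * I))‖ ≤ max C C' * Real.exp (-(V * y)) := by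
  obtain ⟨θ₀, hθ0, hθhalf, hIN⟩ := exists_angle_of_lt hR0 ha hV
  have hC0 : 0 ≤ C := nonneg_of_norm_le_exp hC
  have hpi := Real.two_le_pi
  set α : ℝ := Real.pi - θ₀ with hα
  have hα0 : 0 < α := by rw [hα]; linarith
  have hαπ : α < Real.pi := by rw [hα]; linarith
  have hcosα : Real.cos α = -Real.cos θ₀ := by rw [hα, Real.cos_pi_sub]
  have hsinα : Real.sin α = Real.sin θ₀ := by rw [hα, Real.sin_pi_sub]
  -- norms and real parts on rays
  have hnorm_ray : ∀ (r β : ℝ), 0 ≤ r → ‖(r : ℂ) * cexp (β * I)‖ = r := fun r β hr ↦ by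
    rw [norm_mul, Complex.norm_exp_ofReal_mul_I, mul_one, Complex.norm_real,
      Real.norm_of_nonneg hr]
  have hre_ray : ∀ (w : ℂ) (r β : ℝ),
      (w * (r * cexp (β * I))).re = r * (w.re * Real.cos β - w.im * Real.sin β) := by
    intro w r β
    rw [Complex.exp_mul_I, ← Complex.ofReal_cos, ← Complex.ofReal_sin]
    simp only [mul_re, mul_im, add_re, add_im, ofReal_re, ofReal_im, I_re, I_im]
    ring
  -- `F_w = ρ · e^{wz}` is entire of exponential type and `‖F_w z‖ = ‖ρ z‖ e^{Re(wz)}`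
  have hFd : ∀ w : ℂ, Differentiable ℂ (fun z ↦ ρ z * cexp (w * z)) := fun w ↦
    hρ.mul (differentiable_id.const_mul w).cexp
  have hFn : ∀ w z : ℂ, ‖ρ z * cexp (w * z)‖ = ‖ρ z‖ * Real.exp ((w * z).re) := fun w z ↦ by
    rw [norm_mul, Complex.norm_exp]
  have hFb : ∀ w z : ℂ, ‖ρ z * cexp (w * z)‖ ≤ C * Real.exp ((R + ‖w‖) * ‖z‖) := by
    intro w z
    rw [hFn]
    have h1 : (w * z).re ≤ ‖w‖ * ‖z‖ := (re_le_norm _).trans (norm_mul_le _ _)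
    calc ‖ρ z‖ * Real.exp ((w * z).re) ≤ C * Real.exp (R * ‖z‖) * Real.exp (‖w‖ * ‖z‖) :=
          mul_le_mul (hC z) (Real.exp_le_exp.2 h1) (Real.exp_pos _).le (by positivity)
      _ = C * Real.exp ((R + ‖w‖) * ‖z‖) := by rw [add_mul, Real.exp_add]; ring
  -- on the ray `arg z = 0`: `‖F_w (r)‖ ≤ C'` when `Re w = a`
  have hray0 : ∀ w : ℂ, w.re = a → ∀ r : ℝ, 0 ≤ r → ‖ρ r * cexp (w * r)‖ ≤ max C C' := by
    intro w hw r hr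
    rw [hFn, mul_re, ofReal_re, ofReal_im, mul_zero, sub_zero, hw]
    calc ‖ρ r‖ * Real.exp (a * r) ≤ C' * Real.exp (-(a * r)) * Real.exp (a * r) :=
          mul_le_mul_of_nonneg_right (hdec r hr) (Real.exp_pos _).le
      _ = C' := by rw [mul_assoc, ← Real.exp_add, neg_add_cancel, Real.exp_zero, mul_one]
      _ ≤ max C C' := le_max_right _ _
  -- on a ray `arg z = β` with `R + Re(w e^{iβ}) ≤ 0`: `‖F_w‖ ≤ C`
  have hray1 : ∀ (w : ℂ) (β : ℝ), R + (w.re * Real.cos β - w.im * Real.sin β) ≤ 0 →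
      ∀ r : ℝ, 0 ≤ r → ‖ρ (r * cexp (β * I)) * cexp (w * (r * cexp (β * I)))‖ ≤ max C C' := by
    intro w β hβ r hr
    rw [hFn, hre_ray]
    have hρr : ‖ρ (r * cexp (β * I))‖ ≤ C * Real.exp (R * r) := by
      have h := hC (r * cexp (β * I)); rwa [hnorm_ray r β hr] at h
    calc ‖ρ (r * cexp (β * I))‖ * Real.exp (r * (w.re * Real.cos β - w.im * Real.sin β))
        ≤ C * Real.exp (R * r) * Real.exp (r * (w.re * Real.cos β - w.im * Real.sin β)) :=
          mul_le_mul_of_nonneg_right hρr (Real.exp_pos _).le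
      _ = C * Real.exp (r * (R + (w.re * Real.cos β - w.im * Real.sin β))) := by
          rw [mul_assoc, ← Real.exp_add]; ring_nf
      _ ≤ C * 1 := by
          refine mul_le_mul_of_nonneg_left ?_ hC0
          rw [Real.exp_le_one_iff]
          exact mul_nonpos_of_nonneg_of_nonpos hr hβ
      _ ≤ max C C' := by rw [mul_one]; exact le_max_left _ _
  constructor
  · -- upper half-plane: `w = a - iV`, sector `0 ≤ arg ≤ α`, evaluated at `arg = π/2`
    set w : ℂ := (a : ℂ) - V * I with hw
    have hw_re : w.re = a := by simp [hw]
    have hw_im : w.im = -V := by simp [hw]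
    have hcond : R + (w.re * Real.cos α - w.im * Real.sin α) ≤ 0 := by
      rw [hw_re, hw_im, hcosα, hsinα]; linarith
    have key := PhragmenLindelof.sector_of_norm_le_exp (hFd w) (hFb w) (θ₁ := 0) hα0 hαπ
      (C := max C C') (fun r hr ↦ by simpa using hray0 w hw_re r hr)
      (fun r hr ↦ by simpa using hray1 w α hcond r hr) hy (θ := Real.pi / 2)
      (by positivity) (by rw [hα]; linarith)
    have hI : (y : ℂ) * cexp ((Real.pi / 2 : ℝ) * I) = y * I := by
      rw [Complex.exp_mul_I, ← Complex.ofReal_cos, ← Complex.ofReal_sin, Real.cos_pi_div_two,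
        Real.sin_pi_div_two]
      simp
    rw [hI, hFn] at key
    have hre : (w * (y * I)).re = V * y := by
      rw [mul_re, hw_re, hw_im, mul_I_re, mul_I_im, ofReal_re, ofReal_im]; ring
    rw [hre] at key
    calc ‖ρ (y * I)‖ = ‖ρ (y * I)‖ * Real.exp (V * y) * Real.exp (-(V * y)) := by
          rw [mul_assoc, ← Real.exp_add, add_neg_cancel, Real.exp_zero, mul_one]
      _ ≤ max C C' * Real.exp (-(V * y)) :=
          mul_le_mul_of_nonneg_right key (Real.exp_pos _).le
  · -- lower half-plane: `w = a + iV`, sector `θ₀ - π ≤ arg ≤ 0`, evaluated at `arg = -π/2`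
    set w : ℂ := (a : ℂ) + V * I with hw
    have hw_re : w.re = a := by simp [hw]
    have hw_im : w.im = V := by simp [hw]
    have hcond : R + (w.re * Real.cos (θ₀ - Real.pi) - w.im * Real.sin (θ₀ - Real.pi)) ≤ 0 := by
      rw [hw_re, hw_im, Real.cos_sub_pi, Real.sin_sub_pi]; linarith
    have hsum : ((θ₀ - Real.pi : ℝ) : ℂ) + (α : ℂ) = 0 := by
      rw [hα]; push_cast; ring
    have key := PhragmenLindelof.sector_of_norm_le_exp (hFd w) (hFb w) (θ₁ := θ₀ - Real.pi)
      hα0 hαπ (C := max C C') (fun r hr ↦ hray1 w _ hcond r hr)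
      (fun r hr ↦ by rw [hsum]; simpa using hray0 w hw_re r hr) hy (θ := -(Real.pi / 2))
      (by linarith) (by rw [hα]; linarith)
    have hI : (y : ℂ) * cexp ((-(Real.pi / 2) : ℝ) * I) = -(y * I) := by
      rw [Complex.exp_mul_I, ← Complex.ofReal_cos, ← Complex.ofReal_sin, Real.cos_neg,
        Real.sin_neg, Real.cos_pi_div_two, Real.sin_pi_div_two]
      simp
    rw [hI, hFn] at key
    have hre : (w * -(y * I)).re = V * y := by
      rw [mul_re, hw_re, hw_im, neg_re, neg_im, mul_I_re, mul_I_im, ofReal_re, ofReal_im]; ring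
    rw [hre] at key
    calc ‖ρ (-(y * I))‖ = ‖ρ (-(y * I))‖ * Real.exp (V * y) * Real.exp (-(V * y)) := by
          rw [mul_assoc, ← Real.exp_add, add_neg_cancel, Real.exp_zero, mul_one]
      _ ≤ max C C' * Real.exp (-(V * y)) :=
          mul_le_mul_of_nonneg_right key (Real.exp_pos _).le

/-- **The indicator inequality `h(0) + h(π) ≥ 0` (Steuding's Lemma 5.8 in the form needed for
Voronin's theorem).** An entire function `ρ` with `‖ρ(z)‖ ≤ C e^{R‖z‖}` (`R ≥ 0`) which decays on
the positive real axis like `‖ρ(x)‖ ≤ C' e^{-ax}` with `a > R` vanishes identically.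
Equivalently: for `ρ ≠ 0` of exponential type with `‖ρ(z)‖ ≤ C e^{R‖z‖}`,
`limsup_{x → +∞} log ‖ρ(x)‖ / x ≥ -R` (for `ρ(x) = ∫ e^{-sx} dμ(s)`, `supp μ ⊂ {‖s‖ ≤ R}`, this is
Steuding's Lemma 5.8 / Kowalski's Lemma A.5.2 (3)). Proof: `norm_le_exp_neg_of_decay` and the
quadrant principle give super-exponential decay of `z ↦ ρ((1+i)z)` on `ℝ₊` and boundedness on
`iℝ`; conclude by Mathlib's `eq_zero_on_right_half_plane_of_superexponential_decay` and the
identity theorem. [cite: Steuding2007, Lemma 5.8] [cite: Boas1954, §5.4] -/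
theorem eq_zero_of_norm_le_exp_of_decay {ρ : ℂ → ℂ} (hρ : Differentiable ℂ ρ) {C R : ℝ}
    (hR0 : 0 ≤ R) (hC : ∀ z, ‖ρ z‖ ≤ C * Real.exp (R * ‖z‖)) {C' a : ℝ} (ha : R < a)
    (hdec : ∀ x : ℝ, 0 ≤ x → ‖ρ x‖ ≤ C' * Real.exp (-(a * x))) (z : ℂ) : ρ z = 0 := by
  have ha0 : 0 < a := hR0.trans_lt ha
  have hC0 : 0 ≤ C := nonneg_of_norm_le_exp hC
  set K : ℝ := max C C' with hK
  have hK0 : 0 ≤ K := hC0.trans (le_max_left _ _)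
  have himag := fun (V : ℝ) (hV : 0 ≤ V) (y : ℝ) (hy : 0 ≤ y) ↦
    norm_le_exp_neg_of_decay hρ hR0 hC ha hdec hV hy
  have hre' : ∀ x : ℝ, 0 ≤ x → ‖ρ x‖ ≤ C' * Real.exp (-a * x) := fun x hx ↦ by
    rw [neg_mul]; exact hdec x hx
  -- quadrant bounds
  have hQ1 : ∀ V : ℝ, 0 ≤ V → ∀ z : ℂ, 0 ≤ z.re → 0 ≤ z.im →
      ‖ρ z‖ ≤ max C' K * Real.exp (-a * z.re + -V * z.im) := fun V hV z h1 h2 ↦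
    norm_le_exp_quadrant_I hρ hC hre' (fun y hy ↦ by rw [neg_mul]; exact (himag V hV y hy).1)
      h1 h2
  have hQ4 : ∀ V : ℝ, 0 ≤ V → ∀ z : ℂ, 0 ≤ z.re → z.im ≤ 0 →
      ‖ρ z‖ ≤ max K C' * Real.exp (-V * (-z.im) + -a * z.re) := fun V hV z h1 h2 ↦
    norm_le_exp_quadrant_IV hρ hC hre' (fun y hy ↦ by rw [neg_mul]; exact (himag V hV y hy).2)
      h1 h2
  have hQ2 : ∀ z : ℂ, z.re ≤ 0 → 0 ≤ z.im →
      ‖ρ z‖ ≤ max K C * Real.exp (-R * z.im + R * (-z.re)) := fun z h1 h2 ↦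
    norm_le_exp_quadrant_II hρ hC (C₁ := C) (s := R)
      (fun x hx ↦ by simpa [abs_of_nonneg hx] using hC (-x))
      (fun y hy ↦ by rw [neg_mul]; exact (himag R hR0 y hy).1) h1 h2
  -- the rotated function `f(w) = ρ((1+i)w)`
  have h11 : (1 + I : ℂ) ≠ 0 := by
    intro h; have := congrArg Complex.re h; simp at this
  set f : ℂ → ℂ := fun w ↦ ρ ((1 + I) * w) with hf
  have hfd : Differentiable ℂ f := hρ.comp (differentiable_id.const_mul _)
  have hfb : ∀ w, ‖f w‖ ≤ C * Real.exp ((R * ‖(1 : ℂ) + I‖) * ‖w‖) := fun w ↦ by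
    simp only [hf]
    calc ‖ρ ((1 + I) * w)‖ ≤ C * Real.exp (R * ‖(1 + I) * w‖) := hC _
      _ = C * Real.exp ((R * ‖(1 : ℂ) + I‖) * ‖w‖) := by rw [norm_mul, mul_assoc]
  have hre1 : ∀ x : ℝ, ((1 + I) * (x : ℂ)).re = x := fun x ↦ by simp
  have him1 : ∀ x : ℝ, ((1 + I) * (x : ℂ)).im = x := fun x ↦ by simp
  have hre2 : ∀ y : ℝ, ((1 + I) * ((y : ℂ) * I)).re = -y := fun y ↦ by
    simp [mul_re]
  have him2 : ∀ y : ℝ, ((1 + I) * ((y : ℂ) * I)).im = y := fun y ↦ by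
    simp [mul_im]
  have hzero : EqOn f 0 {w : ℂ | 0 ≤ w.re} := by
    refine PhragmenLindelof.eq_zero_on_right_half_plane_of_superexponential_decay
      hfd.diffContOnCl (isBigO_exp_of_norm_le_exp hfb _) (fun n ↦ ?_)
      ⟨max (max K C) (max K C'), fun y ↦ ?_⟩
    · -- super-exponential decay on `ℝ₊` (rate `V = n + 1`)
      have hV : (0 : ℝ) ≤ n + 1 := by positivity
      have hbound : ∀ x : ℝ, 0 ≤ x → Real.exp x ^ n * ‖f x‖ ≤ max C' K * Real.exp (-x) := by
        intro x hx
        have h := hQ1 (n + 1) hV ((1 + I) * x) (by rw [hre1]; exact hx) (by rw [him1]; exact hx)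
        rw [hre1, him1] at h
        simp only [hf]
        calc Real.exp x ^ n * ‖ρ ((1 + I) * x)‖
            ≤ Real.exp x ^ n * (max C' K * Real.exp (-a * x + -(n + 1) * x)) :=
              mul_le_mul_of_nonneg_left h (by positivity)
          _ = max C' K * Real.exp (-x - a * x) := by
              rw [← Real.exp_nat_mul, mul_left_comm, ← Real.exp_add]
              congr 1; ring_nf
          _ ≤ max C' K * Real.exp (-x) := by
              refine mul_le_mul_of_nonneg_left (Real.exp_le_exp.2 ?_) (le_max_of_le_right hK0)
              nlinarith
      refine tendsto_of_tendsto_of_tendsto_of_le_of_le' tendsto_const_nhds ?_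
        (Eventually.of_forall fun x ↦ by positivity) ((eventually_ge_atTop 0).mono hbound)
      have h := (tendsto_const_nhds (x := max C' K)).mul Real.tendsto_exp_neg_atTop_nhds_zero
      rwa [mul_zero] at h
    · -- boundedness on `iℝ`
      simp only [hf]
      rcases le_total 0 y with hy | hy
      · have h := hQ2 ((1 + I) * (y * I)) (by rw [hre2]; linarith) (by rw [him2]; exact hy)
        rw [hre2, him2, neg_neg] at h
        calc ‖ρ ((1 + I) * (y * I))‖ ≤ max K C * Real.exp (-R * y + R * y) := h
          _ = max K C := by rw [neg_mul, neg_add_cancel, Real.exp_zero, mul_one]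
          _ ≤ _ := le_max_left _ _
      · have h := hQ4 0 le_rfl ((1 + I) * (y * I)) (by rw [hre2]; linarith)
          (by rw [him2]; exact hy)
        rw [hre2, him2] at h
        calc ‖ρ ((1 + I) * (y * I))‖ ≤ max K C' * Real.exp (-0 * -y + -a * -y) := h
          _ ≤ max K C' * 1 := by
              refine mul_le_mul_of_nonneg_left ?_ (le_max_of_le_left hK0)
              rw [Real.exp_le_one_iff]; nlinarith
          _ ≤ _ := by rw [mul_one]; exact le_max_right _ _
  -- identity theorem: `ρ = 0` near `1 + i`, hence everywhere
  have hρan : AnalyticOnNhd ℂ ρ univ := fun w _ ↦ hρ.analyticAt w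
  have hev : ρ =ᶠ[𝓝 (1 + I)] 0 := by
    have hopen : IsOpen {w : ℂ | 0 < (w / (1 + I)).re} :=
      isOpen_lt continuous_const (Complex.continuous_re.comp (continuous_id.div_const _))
    have hmem : (1 + I : ℂ) ∈ {w : ℂ | 0 < (w / (1 + I)).re} := by
      show 0 < ((1 + I) / (1 + I) : ℂ).re
      rw [div_self h11]; simp
    filter_upwards [hopen.mem_nhds hmem] with w hw
    have hw' : ρ w = f (w / (1 + I)) := by
      simp only [hf]; congr 1; field_simp
    rw [hw']
    exact hzero (le_of_lt hw)
  exact hρan.eqOn_zero_of_preconnected_of_eventuallyEq_zero isPreconnected_univ (mem_univ _) hev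
    (mem_univ z)

end Literature.Analysis.Complex
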